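import Literature.NumberTheory.LFunctions.FamilyNonvanishingLandauSiegel
import HarnessLib

/-!
# Uniform non-vanishing of central values `L(½,f)` with a value floor for newforms of prime level
# (Wei–Yang–Zhao 2024, arXiv:2410.09593, the case `F = ℚ`)

Topic `Literature/NumberTheory/LFunctions` (namespace `Literature.NumberTheory.LFunctions`; the
paper's objects live in the sub-namespace `WeiYangZhao2024`). STATEMENT LAYER (D-0014): one honest
definition — the NATURAL (unweighted) proportion of newforms `f ∈ H_k(q) = newforms0 q k` whose
central value `L(½,f)` (the tree's `IwaniecSarnak.centralValue`, analytic normalisation, file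
`FamilyNonvanishingLandauSiegel.lean`) is at least a floor `η` (`floorProportion`) — with its
elementary API, the three printed statements for `F = ℚ` as NAMED FACTS (`def … : Prop`, status
theorem-in-print, not proved here), and one PROVED consequence (the iterated limit (1.7) follows from
the fixed-level weight-aspect bound (1.4)). Typed for the Landau–Siegel programme (rung F-S3, §C
harvest rows r7-T27/r7-T28; §B-fam family E-fam-aspect; §E): a further instance of the "edge law" of
the family route — at fixed weight the proportion with floor is exactly `¼` of ALL newforms of prime
level (`= ½` of the even forms, the Iwaniec–Sarnak edge), reached with a one-piece mollifier of
length up to the square root of the conductor — now WITH the value floor `(log q)⁻²` in the natural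
count, and with the first proportion that is uniform in BOTH the weight and the level. Nothing here is
a claim about Landau–Siegel zeros; the source does not mention them.

VOCABULARY REUSED, NOT RE-DECLARED: `newforms0 q k` (normalised Hecke newforms in `S_k(Γ₀(q))`,
`Literature.NumberTheory.EllipticCurves.ModularForms`, file `EllipticCurves/Newforms.lean`),
`IwaniecSarnak.centralValue f` (`L(½,f) = Σ λ_f(n) n^{-1/2}` continued; file
`FamilyNonvanishingLandauSiegel.lean`, where the harmonic-weight record `UntwistedProportion`,
`iwaniec2006_untwistedHalf` lives). The level-one weight-aspect statement (1.3) of the source is, for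
`F = ℚ`, Balkanova–Frolenkov 2021 Thm 1.1, already typed as
`balkanovaFrolenkov2021_theorem11` (file `LevelOneCentralValuesWeightAspect.lean`) — cited, not retyped.

## What the source prints (held text `paper:arxiv-2410.09593`, pages p0003–p0007, read 2026-08-26)

Z. Wei, L. Yang, S. Zhao, *Relative trace formula and uniform non-vanishing of central `L`-values
of Hilbert modular forms*, arXiv:2410.09593 (2024) [WeiYangZhao2024]. `F` totally real of degree
`d_F`; `𝔮 = 𝒪_F` or a prime ideal; `𝐤 = (k_v)_{v∣∞} ∈ (2ℤ)^{d_F}`, `𝐤 ≥ 𝟒` iff all `k_v ≥ 4`,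
`‖𝐤‖ = Π k_v`; `𝓕(𝐤,𝔮)` = "the set of cuspidal automorphic representations `π` of `PGL₂` over `F`
of level `𝔮` and holomorphic of weight `𝐤`, which is equivalent to the set of normalized Hilbert
newforms of weight `𝐤` and level `𝔮`" (p0003:L23; arithmetic conductor EXACTLY `𝔮`, p0006 §1.4.6);
`L(s,π) = Σ_{𝔪} λ_π(𝔪) N(𝔪)^{−s}` (p0007:L14, finite part, analytic normalisation, `λ_π` the Hecke
eigenvalues); `#` = natural count.

> **Theorem 1.1** (p0003:L27–L40). Suppose `𝐤 ≥ 𝟒`. Let `0 < ε < 10⁻³`,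
> `(log N(𝔮)‖𝐤‖)^ε ≤ ξ ≤ N(𝔮)^{1/2−ε}‖𝐤‖^{1/4−ε}`, and `(log ξ)^{3/2+ε} < A ≤ +∞`. Then
> `#{π ∈ 𝓕(𝐤,𝔮) : L(1/2,π) > A⁻¹}/#𝓕(𝐤,𝔮) ≥ (1−ε)(𝓜⁽¹⁾_{𝔮,𝐤})²/(2N(𝔮)𝓜⁽²⁾_{𝔮,𝐤})` when
> `‖𝐤‖N(𝔮)` is sufficiently large [explicit `𝓜⁽¹⁾, 𝓜⁽²⁾` displayed there].
> **Corollary 1.2** (p0003:L44–L53). Suppose `𝐤 ≥ 𝟒`. Then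
> `liminf_{N(𝔮)‖𝐤‖→+∞} #{π ∈ 𝓕(𝐤,𝔮) : L(1/2,π) ≥ (log N(𝔮)‖𝐤‖)⁻²}/#𝓕(𝐤,𝔮) ≥ 1/100`.
> "This can be regarded as an unconditional uniform non-vanishing result, whereas in [ILS2000], the
> stronger result `c = 1/8` was proved under the assumption of the generalized Riemann hypothesis."
> **Corollary 1.3** (p0003:L57–p0004:L11). Let `𝐤 ≥ 𝟒`. • Suppose `𝐤` is fixed. Then
> `liminf_{N(𝔮)→+∞} #{π ∈ 𝓕(𝐤,𝔮) : L(1/2,π) ≥ (log N(𝔮))⁻²}/#𝓕(𝐤,𝔮) ≥ 1/4` (1.2).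
> • Assume `Σ_v k_v ≡ 0 (mod 4)`. Then `liminf_{‖𝐤‖→∞} #{π ∈ 𝓕(𝐤,𝒪_F) : L(1/2,π) ≥ (log‖𝐤‖)⁻²}/# ≥ 1/5`
> (1.3). • Suppose `𝔮 ⊊ 𝒪_F` is fixed. Then
> `liminf_{‖𝐤‖→+∞} #{π ∈ 𝓕(𝐤,𝔮) : L(1/2,π) ≥ (log‖𝐤‖)⁻²}/#𝓕(𝐤,𝔮) ≥ (1−N(𝔮)⁻¹)³/(10(1+N(𝔮)⁻¹))`
> (1.4). • Along `‖𝐤‖ → +∞` and `N(𝔮) → +∞`, we have `liminf_{N(𝔮)→+∞} liminf_{‖𝐤‖→+∞} … ≥ 1/10` (1.7).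
> "Note that (1.2) aligns with the result in [Trotabas2011]; when `F = ℚ`, (1.3) reduces to the main
> result in [BF21]. … Furthermore, (1.4) and (1.7) appear to be new, even in the classical case of
> `F = ℚ`."

## Lean rendering / faithfulness notes (for ls-lit-ref)

* SPECIAL CASE TYPED: `F = ℚ` only. Then `𝔮 = (q)` with `q` a rational prime, `N(𝔮) = q`,
  `‖𝐤‖ = k`, and `𝓕(𝐤,𝔮) = newforms0 q k` (normalised newforms of weight `k`, level `Γ₀(q)`,
  trivial character — conductor exactly `q`); `L(½,π_f) = IwaniecSarnak.centralValue f`, whose real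
  part is compared with the floor exactly as in `IwaniecSarnak.UntwistedProportion`.
  -- TODO(general form): totally real `F` (Hilbert newforms of weight `𝐤`, level `𝔮`; no
  Hilbert-modular / adelic `PGL₂/F` vocabulary in the tree on 2026-08-26).
* "`liminf_{x→∞} a(x) ≥ c`" is typed as `∀ ε > 0, ∃ x₀, ∀ x ≥ x₀, c − ε ≤ a(x)`; the floor `(log ·)⁻²`
  with the natural logarithm, as printed.
* Corollary 1.2 is typed over PRIME levels `q` only (`𝔮 ⊊ 𝒪_F`), with `q·k → ∞`: for `𝔮 = 𝒪_F` and
  `Σ k_v ≢ 0 (mod 4)` every `π ∈ 𝓕(𝐤,𝒪_F)` has root number `−1` and `L(½,π) = 0`, and the source's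
  own Theorem 1.1 bound degenerates there (`𝓜⁽¹⁾_{𝒪_F,𝐤} = 4δ_𝐤 = 0`); the prime-level family is
  the part of the printed `liminf` that Theorem 1.1 supports with a positive bound, and restricting a
  `liminf` lower bound to a sub-family only weakens the statement. Recorded, not adjudicated.
* (1.3) for `F = ℚ` is NOT retyped (it is `balkanovaFrolenkov2021_theorem11`, level-one vocabulary).
* `floorProportion` is a junk `0/0 = 0` when `newforms0 q k` is empty (it is non-empty for the large
  prime levels in play; `dim S_k(Γ₀(q)) → ∞`).
-/

noncomputable section

open scoped MatrixGroups
open CongruenceSubgroup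
open Literature.NumberTheory.EllipticCurves.ModularForms

namespace Literature.NumberTheory.LFunctions

namespace WeiYangZhao2024

open IwaniecSarnak

/-! ### Vocabulary: the natural proportion of newforms with central value above a floor -/

/-- **The natural proportion of `H_k(q)` with `L(½,f) ≥ η`**:
`#{f ∈ H_k(q) : L(½,f) ≥ η} / #H_k(q)` with `H_k(q) = newforms0 q k` (normalised newforms of weight
`k` and level `Γ₀(q)`), `L(½,f) = IwaniecSarnak.centralValue f` (real part compared with the floor,
as in `IwaniecSarnak.UntwistedProportion`), unweighted count (the source's `#`); junk `0` if
`H_k(q) = ∅`. For `F = ℚ`, `𝔮 = (q)` this is the quotient displayed in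
[cite: WeiYangZhao2024, Thm 1.1 and Cor 1.2–1.3 (arXiv p. 3)]. -/
def floorProportion (q : ℕ) [NeZero q] (k : ℤ) (η : ℝ) : ℝ :=
  (Set.ncard {f : CuspForm (Gamma0 q) k | f ∈ newforms0 q k ∧ η ≤ (centralValue f).re} : ℝ) /
    (Set.ncard (newforms0 q k) : ℝ)

/-- Unfolding `floorProportion`. [cite: WeiYangZhao2024, Cor 1.3 (arXiv p. 3)] -/
theorem floorProportion_def (q : ℕ) [NeZero q] (k : ℤ) (η : ℝ) :
    floorProportion q k η =
      (Set.ncard {f : CuspForm (Gamma0 q) k | f ∈ newforms0 q k ∧ η ≤ (centralValue f).re} : ℝ) /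
        (Set.ncard (newforms0 q k) : ℝ) :=
  rfl

/-- The counted set is a subset of `H_k(q)`. [cite: WeiYangZhao2024, Cor 1.3 (arXiv p. 3)] -/
theorem floorSet_subset (q : ℕ) [NeZero q] (k : ℤ) (η : ℝ) :
    {f : CuspForm (Gamma0 q) k | f ∈ newforms0 q k ∧ η ≤ (centralValue f).re} ⊆ newforms0 q k :=
  fun _ hf ↦ hf.1

/-- `floorProportion` is non-negative. [cite: WeiYangZhao2024, Cor 1.3 (arXiv p. 3)] -/
theorem floorProportion_nonneg (q : ℕ) [NeZero q] (k : ℤ) (η : ℝ) : 0 ≤ floorProportion q k η :=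
  div_nonneg (Nat.cast_nonneg _) (Nat.cast_nonneg _)

/-- `floorProportion ≤ 1` (the counted set is a subset of the finite set `H_k(q)`; finiteness is the
tree fact `finite_newforms0`, supplied as a hypothesis). [cite: WeiYangZhao2024, Cor 1.3 (arXiv p. 3)] -/
theorem floorProportion_le_one (q : ℕ) [NeZero q] (k : ℤ) (η : ℝ) (hfin : (newforms0 q k).Finite) :
    floorProportion q k η ≤ 1 := by
  unfold floorProportion
  have hle : (Set.ncard {f : CuspForm (Gamma0 q) k | f ∈ newforms0 q k ∧ η ≤ (centralValue f).re} : ℝ)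
      ≤ (Set.ncard (newforms0 q k) : ℝ) := by
    exact_mod_cast Set.ncard_le_ncard (floorSet_subset q k η) hfin
  rcases eq_or_lt_of_le (Nat.cast_nonneg (α := ℝ) (Set.ncard (newforms0 q k))) with h0 | hpos
  · rw [← h0, div_zero]; exact zero_le_one
  · rwa [div_le_one hpos]

/-- Raising the floor can only lower the proportion: `η ≤ η' → P(η') ≤ P(η)` (finiteness of `H_k(q)`
as a hypothesis). In particular a proportion with the floor `(log q)⁻²` is also a proportion of
non-vanishing. [cite: WeiYangZhao2024, Thm 1.1 (arXiv p. 3, the parameter `A`)] -/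
theorem floorProportion_anti (q : ℕ) [NeZero q] (k : ℤ) {η η' : ℝ} (h : η ≤ η')
    (hfin : (newforms0 q k).Finite) : floorProportion q k η' ≤ floorProportion q k η := by
  unfold floorProportion
  refine div_le_div_of_nonneg_right ?_ (Nat.cast_nonneg _)
  have hsub : {f : CuspForm (Gamma0 q) k | f ∈ newforms0 q k ∧ η' ≤ (centralValue f).re} ⊆
      {f : CuspForm (Gamma0 q) k | f ∈ newforms0 q k ∧ η ≤ (centralValue f).re} :=
    fun f hf ↦ ⟨hf.1, h.trans hf.2⟩
  exact_mod_cast Set.ncard_le_ncard hsub (hfin.subset (floorSet_subset q k η))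

/-- A positive proportion above a positive floor exhibits a newform with `L(½,f) ≥ η > 0`, in
particular with `L(½,f) ≠ 0`. [cite: WeiYangZhao2024, Cor 1.3 (arXiv p. 3)] -/
theorem exists_of_floorProportion_pos (q : ℕ) [NeZero q] (k : ℤ) {η : ℝ}
    (h : 0 < floorProportion q k η) :
    ∃ f : CuspForm (Gamma0 q) k, f ∈ newforms0 q k ∧ η ≤ (centralValue f).re := by
  unfold floorProportion at h
  have hnum : Set.ncard {f : CuspForm (Gamma0 q) k | f ∈ newforms0 q k ∧ η ≤ (centralValue f).re} ≠ 0 := by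
    intro h0
    rw [h0, Nat.cast_zero, zero_div] at h
    exact lt_irrefl _ h
  obtain ⟨f, hf⟩ := Set.nonempty_of_ncard_ne_zero hnum
  exact ⟨f, hf⟩

end WeiYangZhao2024

/-! ### The printed record for `F = ℚ` (named facts) -/

open WeiYangZhao2024 IwaniecSarnak

/-- **Wei–Yang–Zhao 2024, Corollary 1.3 (1.2), the case `F = ℚ`** (NAMED FACT, theorem-in-print,
not proved here). "Suppose `𝐤 (≥ 𝟒)` is fixed. Then
`liminf_{N(𝔮)→+∞} #{π ∈ 𝓕(𝐤,𝔮) : L(1/2,π) ≥ (log N(𝔮))⁻²}/#𝓕(𝐤,𝔮) ≥ 1/4`" — over `ℚ`: for every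
even weight `k ≥ 4` and every `ε > 0`, for all sufficiently large PRIMES `q`, at least a proportion
`¼ − ε` of the newforms `f ∈ H_k(q)` (natural count, all root numbers) have `L(½,f) ≥ (log q)⁻²`.
(The authors: "(1.2) aligns with the result in [Trotabas2011]"; `¼` of all `= ½` of the even forms,
the Iwaniec–Sarnak edge, here with the value floor in the natural count.)
-- TODO(general form): totally real `F`, Hilbert newforms of prime level `𝔮`.
[cite: WeiYangZhao2024, Cor 1.3 (1.2) (arXiv p. 3)] -/
def weiYangZhao2024_levelAspect : Prop :=
  ∀ k : ℤ, 4 ≤ k → Even k → ∀ eps : ℝ, 0 < eps → ∃ q₀ : ℕ, ∀ (q : ℕ) [NeZero q], q.Prime → q₀ ≤ q →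
    1 / 4 - eps ≤ floorProportion q k ((Real.log q)⁻¹ ^ 2)

/-- **Wei–Yang–Zhao 2024, Corollary 1.3 (1.4), the case `F = ℚ`** (NAMED FACT, theorem-in-print,
not proved here; "appear[s] to be new, even in the classical case of `F = ℚ`"). "Suppose `𝔮 ⊊ 𝒪_F`
is fixed. Then `liminf_{‖𝐤‖→+∞} #{π ∈ 𝓕(𝐤,𝔮) : L(1/2,π) ≥ (log‖𝐤‖)⁻²}/#𝓕(𝐤,𝔮) ≥
(1 − N(𝔮)⁻¹)³/(10(1 + N(𝔮)⁻¹))`" — over `ℚ`: for every PRIME `q` and every `ε > 0`, for all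
sufficiently large even weights `k`, at least a proportion `(1−q⁻¹)³/(10(1+q⁻¹)) − ε` of the newforms
`f ∈ H_k(q)` have `L(½,f) ≥ (log k)⁻²`.
-- TODO(general form): totally real `F`, fixed prime ideal `𝔮`, `‖𝐤‖ → ∞`.
[cite: WeiYangZhao2024, Cor 1.3 (1.4) (arXiv p. 4)] -/
def weiYangZhao2024_weightAspectPrimeLevel : Prop :=
  ∀ (q : ℕ) [NeZero q], q.Prime → ∀ eps : ℝ, 0 < eps → ∃ k₀ : ℤ, ∀ k : ℤ, k₀ ≤ k → Even k →
    (1 - (q : ℝ)⁻¹) ^ 3 / (10 * (1 + (q : ℝ)⁻¹)) - eps ≤ floorProportion q k ((Real.log k)⁻¹ ^ 2)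

/-- **Wei–Yang–Zhao 2024, Corollary 1.2, the case `F = ℚ`, prime levels** (NAMED FACT,
theorem-in-print, not proved here). "Suppose that `𝐤 ≥ 𝟒`. Then
`liminf_{N(𝔮)‖𝐤‖→+∞} #{π ∈ 𝓕(𝐤,𝔮) : L(1/2,π) ≥ (log N(𝔮)‖𝐤‖)⁻²}/#𝓕(𝐤,𝔮) ≥ 1/100`" — over `ℚ`
and along PRIME levels: for every `ε > 0` there is `X₀` such that for every prime `q` and every even
`k ≥ 4` with `q·k ≥ X₀`, at least a proportion `1/100 − ε` of `H_k(q)` has `L(½,f) ≥ (log(qk))⁻²` —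
the first proportion-with-floor uniform in weight AND level ("unconditional uniform non-vanishing
result, whereas in [ILS2000] the stronger `c = 1/8` was proved under GRH"). See the file header for why
the level `𝔮 = 𝒪_F` is not included in this rendering.
-- TODO(general form): totally real `F`.
[cite: WeiYangZhao2024, Cor 1.2 (arXiv p. 3)] -/
def weiYangZhao2024_hybrid : Prop :=
  ∀ eps : ℝ, 0 < eps → ∃ X₀ : ℝ, ∀ (q : ℕ) [NeZero q], q.Prime → ∀ k : ℤ, 4 ≤ k → Even k →
    X₀ ≤ (q : ℝ) * (k : ℝ) →
      1 / 100 - eps ≤ floorProportion q k ((Real.log ((q : ℝ) * (k : ℝ)))⁻¹ ^ 2)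

namespace WeiYangZhao2024

open IwaniecSarnak

/-! ### Proved consequences -/

/-- The level-aspect record gives, for every fixed even weight `k ≥ 4` and all large prime levels, a
newform with `L(½,f) ≥ (log q)⁻²` (so `L(½,f) ≠ 0`). PROVED from the named fact.
[cite: WeiYangZhao2024, Cor 1.3 (1.2) (arXiv p. 3)] -/
theorem exists_largeValue_of_levelAspect (h : weiYangZhao2024_levelAspect) {k : ℤ} (hk : 4 ≤ k)
    (hke : Even k) :
    ∃ q₀ : ℕ, ∀ (q : ℕ) [NeZero q], q.Prime → q₀ ≤ q →
      ∃ f : CuspForm (Gamma0 q) k, f ∈ newforms0 q k ∧ (Real.log q)⁻¹ ^ 2 ≤ (centralValue f).re := by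
  obtain ⟨q₀, hq₀⟩ := h k hk hke (1 / 8) (by norm_num)
  refine ⟨q₀, fun q _ hq hle ↦ ?_⟩
  have hP : 1 / 4 - 1 / 8 ≤ floorProportion q k ((Real.log q)⁻¹ ^ 2) := hq₀ q hq hle
  exact exists_of_floorProportion_pos q k (by linarith)

/-- The constant of (1.4) tends to `1/10`: for every `ε > 0`, `(1−q⁻¹)³/(10(1+q⁻¹)) ≥ 1/10 − ε` for
all large `q` (elementary; used to derive (1.7) from (1.4)).
[cite: WeiYangZhao2024, Cor 1.3 (1.4) and (1.7) (arXiv p. 4)] -/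
theorem weightConstant_eventually_ge (eps : ℝ) (heps : 0 < eps) :
    ∃ q₁ : ℕ, ∀ q : ℕ, q₁ ≤ q → 1 / 10 - eps ≤ (1 - (q : ℝ)⁻¹) ^ 3 / (10 * (1 + (q : ℝ)⁻¹)) := by
  -- `(1−x)³/(1+x) ≥ 1 − 4x` for `0 ≤ x ≤ 1`, so `q ≥ 4/(10ε)` (and `q ≥ 1`) suffices.
  obtain ⟨q₁, hq₁⟩ := exists_nat_gt (2 / (5 * eps))
  refine ⟨max q₁ 1, fun q hq ↦ ?_⟩
  have hq1 : (1 : ℝ) ≤ q := by exact_mod_cast (le_max_right q₁ 1).trans hq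
  have hqpos : (0 : ℝ) < q := by linarith
  have hx0 : (0 : ℝ) ≤ (q : ℝ)⁻¹ := inv_nonneg.mpr hqpos.le
  have hx1 : (q : ℝ)⁻¹ ≤ 1 := inv_le_one_of_one_le₀ hq1
  have hqε : 2 / (5 * eps) < q := lt_of_lt_of_le hq₁ (by exact_mod_cast (le_max_left q₁ 1).trans hq)
  -- hence `q⁻¹ < 5ε/2`, i.e. `4 q⁻¹ < 10 ε`
  have hxε : (q : ℝ)⁻¹ * 2 < 5 * eps := by
    have h5 : (0 : ℝ) < 5 * eps := by positivity
    have := (div_lt_iff₀ h5).mp hqε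
    -- this : 2 < q * (5 * eps)
    calc (q : ℝ)⁻¹ * 2 < (q : ℝ)⁻¹ * (q * (5 * eps)) := by
          exact mul_lt_mul_of_pos_left this (inv_pos.mpr hqpos)
      _ = 5 * eps := by field_simp
  set x : ℝ := (q : ℝ)⁻¹ with hx
  have hden : (0 : ℝ) < 10 * (1 + x) := by positivity
  rw [le_div_iff₀ hden]
  -- goal: `(1/10 − ε)·(10(1+x)) ≤ (1−x)³`; indeed RHS − LHS = (10ε − 4x) + x²(3−x) + 10εx ≥ 0.
  have hx3 : 0 ≤ x ^ 2 * (3 - x) := mul_nonneg (sq_nonneg x) (by linarith)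
  have hεx : 0 ≤ eps * x := mul_nonneg heps.le hx0
  nlinarith [hx0, hx1, hxε, heps, hx3, hεx]

/-- **(1.7) from (1.4)**: "Along `‖𝐤‖ → +∞` and `N(𝔮) → +∞`, we have
`liminf_{N(𝔮)→+∞} liminf_{‖𝐤‖→+∞} #{π ∈ 𝓕(𝐤,𝔮) : L(1/2,π) ≥ (log‖𝐤‖)⁻²}/#𝓕(𝐤,𝔮) ≥ 1/10`" — over
`ℚ`: for every `ε > 0`, for all large primes `q`, for all large even `k` (threshold depending on
`q`), the proportion with floor `(log k)⁻²` is `≥ 1/10 − ε`. PROVED here from the named fact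
`weiYangZhao2024_weightAspectPrimeLevel` (the constant `(1−q⁻¹)³/(10(1+q⁻¹))` tends to `1/10`), so (1.7) is not a
separate fact. [cite: WeiYangZhao2024, Cor 1.3 (1.7) (arXiv p. 4)] -/
theorem iteratedLimit_of_weightAspectPrimeLevel (h : weiYangZhao2024_weightAspectPrimeLevel) (eps : ℝ)
    (heps : 0 < eps) :
    ∃ q₁ : ℕ, ∀ (q : ℕ) [NeZero q], q.Prime → q₁ ≤ q → ∃ k₀ : ℤ, ∀ k : ℤ, k₀ ≤ k → Even k →
      1 / 10 - eps ≤ floorProportion q k ((Real.log k)⁻¹ ^ 2) := by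
  obtain ⟨q₁, hq₁⟩ := weightConstant_eventually_ge (eps / 2) (by positivity)
  refine ⟨q₁, fun q _ hq hle ↦ ?_⟩
  obtain ⟨k₀, hk₀⟩ := h q hq (eps / 2) (by positivity)
  refine ⟨k₀, fun k hk hke ↦ ?_⟩
  have h1 := hq₁ q hle
  have h2 := hk₀ k hk hke
  linarith

end WeiYangZhao2024

end Literature.NumberTheory.LFunctions

end
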